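import Summits.AtomisticToContinuum.BoseEinsteinCondensation.Theorems.BECInsertionCorrectorBoundaryTransferWeakModeFreeRigidityTransferLocBdd
import Summits.AtomisticToContinuum.BoseEinsteinCondensation.Theses.BECCutLineWeakDisorder
import Literature.MathematicalPhysics.QuantumManyBody.GroundState
import HarnessLib

/-!
# `BoundaryTransferWeak` (stmt-AtomisticToContinuum-0827), line `mode_free_reward` — piece X₂,
# the MODE-FREE RIGIDITY TRANSFER conditionally on `GroundStateRigidity` (stmt-9072)

Supports stmt-AtomisticToContinuum-0827 (lead c6, stub `stub_modeFreeRigidityTransfer_singular` of the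
working skeleton of `Theses.BECPeriodicReduction.BoundaryTransferWeak`), as a HELPER: the conditional form
of the singular-class stub.

The class (a) sibling `stub_modeFreeRigidityTransfer_locBdd` (essentially locally bounded `v`) is landed
unconditionally in `…ModeFreeRigidityTransferLocBdd`. For the singular class (`v` NOT essentially locally
bounded on `(0, ∞)`: hard cores `⊤·1_{[0,a]}`, hard shells) the one missing input is Dirichlet rigidity of
near-minimisers up to a phase, i.e. the open crux
`Theses.BECCutLineWeakDisorder.GroundStateRigidity` (stmt-AtomisticToContinuum-9072; reduced to its
uniqueness kernel in `…GroundStateRigidityReduction`). This file records the bookkeeping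

* `modeFreeRigidityTransfer_of_groundStateRigidity` — `GroundStateRigidity` ⟹ the mode-free rigidity
  transfer for EVERY admissible `v` (no class restriction): take the density threshold `ρ₀(v)` of the crux
  as `ρ₁`, and on its eventual set apply the landed fixed-box transfer
  `ModeFreeReward.le_condensateNumber_of_rigid_of_condensed`;
* `stub_modeFreeRigidityTransfer_singular_of_groundStateRigidity` — the registered singular-class stub
  verbatim, conditionally on `GroundStateRigidity` (the class hypothesis is idle).

References: E. H. Lieb, R. Seiringer, J. P. Solovej, J. Yngvason, *The Mathematics of the Bose Gas and its
Condensation* (2005), §1.2 (1.17)–(1.19) [LSSY2005]; M. Reed, B. Simon, *Methods of Modern Mathematical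
Physics IV* (1978), §XIII.12 Thms XIII.46–47 [ReedSimonIV1978].
-/

noncomputable section

open MeasureTheory Filter
open scoped ENNReal NNReal

namespace Summit.AtomisticToContinuum.BoseEinsteinCondensation.ModeFreeReward

open Literature.MathematicalPhysics.QuantumManyBody.BoseGas

/-- **Mode-free rigidity transfer, conditional on `GroundStateRigidity`** (stmt-AtomisticToContinuum-9072),
for EVERY repulsive finite-range `v`: below the density threshold `ρ₀(v)` of the crux and eventually in `N`,
condensed competitors (`λ_max ≥ c'N`) at every slack force `condensateNumber ≥ c''N` for every `c'' < c'`.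
Proof: the crux supplies, eventually in `N`, the `L²`-rigidity of near-minimisers up to a phase, which is
exactly the input `hrig` of the landed fixed-box transfer `le_condensateNumber_of_rigid_of_condensed`; the
hypothesis `E₀ ≠ ⊤` goes unused. [cite: ReedSimonIV1978, §XIII.12 Thm XIII.47] -/
theorem modeFreeRigidityTransfer_of_groundStateRigidity :
    Summit.AtomisticToContinuum.BoseEinsteinCondensation.Theses.BECCutLineWeakDisorder.GroundStateRigidity →
      ∀ v : ℝ → ℝ≥0∞, IsRepulsiveFiniteRange v → ∃ ρ₁ : ℝ, 0 < ρ₁ ∧ ∀ ρ : ℝ, 0 < ρ → ρ < ρ₁ →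
      ∀ c' c'' : ℝ, 0 < c'' → c'' < c' → ∀ᶠ N : ℕ in atTop,
        groundStateEnergy v N (sideLength ρ N) ≠ ⊤ →
        (∀ η : ℝ≥0∞, 0 < η → ∃ Ψ : TrialState N (sideLength ρ N),
          energy v Ψ ≤ groundStateEnergy v N (sideLength ρ N) + η ∧
            ENNReal.ofReal (c' * N) ≤ maxOccupation N Ψ.ψ) →
        ENNReal.ofReal (c'' * N) ≤ condensateNumber v N (sideLength ρ N) := by
  intro hR v hv
  obtain ⟨ρ₀, hρ₀, hrig⟩ := hR v hv
  refine ⟨ρ₀, hρ₀, fun ρ hρ hρlt c' c'' _ hlt => ?_⟩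
  filter_upwards [hrig ρ hρ hρlt] with N hN _ hcomp
  exact le_condensateNumber_of_rigid_of_condensed hlt hN hcomp

/-- **Stub 2b — mode-free rigidity transfer, singular class, conditionally on `GroundStateRigidity`**
(stmt-AtomisticToContinuum-9072): the registered stub `stub_modeFreeRigidityTransfer_singular` verbatim
(`v` repulsive, finite range and NOT essentially locally bounded on `(0, ∞)`), as a corollary of
`modeFreeRigidityTransfer_of_groundStateRigidity`; the class hypothesis is idle. [folklore] -/
theorem stub_modeFreeRigidityTransfer_singular_of_groundStateRigidity :
    Summit.AtomisticToContinuum.BoseEinsteinCondensation.Theses.BECCutLineWeakDisorder.GroundStateRigidity →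
    ∀ v : ℝ → ℝ≥0∞, IsRepulsiveFiniteRange v →
      ¬ (∀ r : ℝ, 0 < r → ∃ C : ℝ≥0, ∀ᵐ s : ℝ, r ≤ s → v s ≤ C) → ∃ ρ₁ : ℝ, 0 < ρ₁ ∧ ∀ ρ : ℝ, 0 < ρ → ρ < ρ₁ →
      ∀ c' c'' : ℝ, 0 < c'' → c'' < c' → ∀ᶠ N : ℕ in atTop,
        groundStateEnergy v N (sideLength ρ N) ≠ ⊤ →
        (∀ η : ℝ≥0∞, 0 < η → ∃ Ψ : TrialState N (sideLength ρ N),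
          energy v Ψ ≤ groundStateEnergy v N (sideLength ρ N) + η ∧
            ENNReal.ofReal (c' * N) ≤ maxOccupation N Ψ.ψ) →
        ENNReal.ofReal (c'' * N) ≤ condensateNumber v N (sideLength ρ N) :=
  fun hR v hv _ => modeFreeRigidityTransfer_of_groundStateRigidity hR v hv

end Summit.AtomisticToContinuum.BoseEinsteinCondensation.ModeFreeReward

end
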